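import Summits.HubbardSuperconductivity.HubbardSuperconductivity.Theorems.WeakCouplingBCSKlLindhardEnclosureCeilStructural

/-!
# KL-MARGIN-SCAN reader (22) «kernel-lindhard-enclosure» — the per-leaf CEILING debt is exactly FIVE rule predicates

`…CeilStructural` reduced `CeilSoundAt P t` (all trees) to the per-leaf predicate `LeafCeilSoundAt P`.  This file opens the fused leaf
`Params.leaf` by cases on the guards, the two shell statuses, the hint payloads and the two `Option` outcomes combined by the leaf's `minO`,
and shows that `LeafCeilSoundAt P` follows from five RULE-level predicates and nothing else: `SameSideZeroAt` (certified same-side cells carry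
NO mass), `CeilCrudeSoundAt` (the crude ceiling, any guarded cell), `CeilChordSoundAt` (chord rule on certified two-shell cells),
`CeilBdrySoundAt` (majorised-hyperbola rule on single-straddle cells, every hint payload) and `CeilTipSoundAt` (tip rule on doubly-straddling
cells, every hint payload).  The `minO` of two certified ceilings is sound because the minimum of two valid upper bounds is one.  Honest
framing: bookkeeping over the landed kernel; the five rule predicates are NOT proved here; floats are floats; nothing in this file asserts a KL
margin at any `t′ ≠ 0`, `K₃`, `U₀`, the window or B1g dominance; a Kohn–Luttinger instability statement is not ODLRO and nothing here
proves superconductivity in the Hubbard model.  (p1 g25, 2026-08-29.)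
-/

noncomputable section

set_option linter.dupNamespace false

namespace Summit.HubbardSuperconductivity.HubbardSuperconductivity.Theorems.KlLindhardEnclosure

open Real Set MeasureTheory Literature.MathematicalPhysics.QuantumLattice
open Summit.HubbardSuperconductivity.HubbardSuperconductivity.Theorems

/-- A CERTIFIED CEILING `N` (units `2^-30`) for grid cell `(a, b, c, d)`: the two-shell integrand is integrable on the whole cell and
`2^30 ∫_cell F ≤ N`. -/
def Params.CeilValid (P : Params) (a b c d N : ℤ) : Prop :=
  IntegrableOn P.integrand (P.cellSet a b c d) volume ∧ 2 ^ 30 * P.cellInt a b c d ≤ (N : ℝ)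

/-- The minimum of two certified ceilings is a certified ceiling. -/
theorem Params.ceilValid_min (P : Params) {a b c d u v : ℤ} (hu : P.CeilValid a b c d u) (hv : P.CeilValid a b c d v) :
    P.CeilValid a b c d (min u v) := by
  rcases min_choice u v with h | h <;> rw [h]
  · exact hu
  · exact hv

/-- **SAME-SIDE RULE SOUNDNESS at `P`**: a guarded cell whose two shell statuses are certified EQUAL carries no mass — the integrand is
integrable on the cell with `2^30 ∫_cell F ≤ 0` (it vanishes there). [folklore] -/
def SameSideZeroAt (P : Params) : Prop :=
  ∀ (a b c d : ℤ) (k : Bool),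
    (P.cell (P.mkX a) (P.mkX b) (P.mkY c) (P.mkY d)).guards = true →
    P.status (P.cell (P.mkX a) (P.mkX b) (P.mkY c) (P.mkY d)).e1Lo (P.cell (P.mkX a) (P.mkX b) (P.mkY c) (P.mkY d)).e1Hi = some k →
    P.status (P.cell (P.mkX a) (P.mkX b) (P.mkY c) (P.mkY d)).e2Lo (P.cell (P.mkX a) (P.mkX b) (P.mkY c) (P.mkY d)).e2Hi = some k →
      P.CeilValid a b c d 0

/-- **CRUDE-CEILING RULE SOUNDNESS at `P`**: on any guarded cell, a crude ceiling `some v` (`F ≤ D/L`, `L` the certified distance sum) is a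
certified ceiling. [folklore] -/
def CeilCrudeSoundAt (P : Params) : Prop :=
  ∀ (a b c d v : ℤ),
    (P.cell (P.mkX a) (P.mkX b) (P.mkY c) (P.mkY d)).guards = true →
    P.ceilCrude (P.cell (P.mkX a) (P.mkX b) (P.mkY c) (P.mkY d)) (P.mkX a) (P.mkX b) (P.mkY c) (P.mkY d) = some v →
      P.CeilValid a b c d v

/-- **CHORD-CEILING RULE SOUNDNESS at `P`**: on a guarded cell with certified OPPOSITE statuses of kind `k`, a chord ceiling `some u` is a
certified ceiling. [folklore] -/
def CeilChordSoundAt (P : Params) : Prop :=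
  ∀ (a b c d : ℤ) (k : Bool) (u : ℤ),
    (P.cell (P.mkX a) (P.mkX b) (P.mkY c) (P.mkY d)).guards = true →
    P.status (P.cell (P.mkX a) (P.mkX b) (P.mkY c) (P.mkY d)).e1Lo (P.cell (P.mkX a) (P.mkX b) (P.mkY c) (P.mkY d)).e1Hi = some k →
    P.status (P.cell (P.mkX a) (P.mkX b) (P.mkY c) (P.mkY d)).e2Lo (P.cell (P.mkX a) (P.mkX b) (P.mkY c) (P.mkY d)).e2Hi = some (!k) →
    P.ceilChord (P.cell (P.mkX a) (P.mkX b) (P.mkY c) (P.mkY d)) k (P.mkX a) (P.mkX b) (P.mkY c) (P.mkY d) = some u →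
      P.CeilValid a b c d u

/-- **MAJORISED-HYPERBOLA RULE SOUNDNESS at `P`**: on a guarded single-straddle cell (`sh = true`: `p + q` straddles, `p` has status `far`;
`sh = false`: `p` straddles, `p + q` has status `far`), for EVERY hint payload `τx τy`, a boundary ceiling `some u` is a certified
ceiling. [folklore] -/
def CeilBdrySoundAt (P : Params) : Prop :=
  ∀ (a b c d : ℤ) (sh far : Bool) (τx τy : ℕ) (u : ℤ),
    (P.cell (P.mkX a) (P.mkX b) (P.mkY c) (P.mkY d)).guards = true →
    P.status (P.cell (P.mkX a) (P.mkX b) (P.mkY c) (P.mkY d)).e1Lo (P.cell (P.mkX a) (P.mkX b) (P.mkY c) (P.mkY d)).e1Hi = (if sh then some far else none) →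
    P.status (P.cell (P.mkX a) (P.mkX b) (P.mkY c) (P.mkY d)).e2Lo (P.cell (P.mkX a) (P.mkX b) (P.mkY c) (P.mkY d)).e2Hi = (if sh then none else some far) →
    P.ceilBdry (P.cell (P.mkX a) (P.mkX b) (P.mkY c) (P.mkY d)) sh (!far) τx τy (P.mkX a) (P.mkX b) (P.mkY c) (P.mkY d) = some u →
      P.CeilValid a b c d u

/-- **TIP RULE SOUNDNESS at `P`**: on a guarded cell where BOTH points may straddle, for EVERY hint payload, a tip ceiling `some u` is a
certified ceiling. [folklore] -/
def CeilTipSoundAt (P : Params) : Prop :=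
  ∀ (a b c d : ℤ) (τx σx τy σy τx' σx' τy' σy' : ℕ) (u : ℤ),
    (P.cell (P.mkX a) (P.mkX b) (P.mkY c) (P.mkY d)).guards = true →
    P.status (P.cell (P.mkX a) (P.mkX b) (P.mkY c) (P.mkY d)).e1Lo (P.cell (P.mkX a) (P.mkX b) (P.mkY c) (P.mkY d)).e1Hi = none →
    P.status (P.cell (P.mkX a) (P.mkX b) (P.mkY c) (P.mkY d)).e2Lo (P.cell (P.mkX a) (P.mkX b) (P.mkY c) (P.mkY d)).e2Hi = none →
    P.ceilTip (P.cell (P.mkX a) (P.mkX b) (P.mkY c) (P.mkY d)) τx σx τy σy τx' σx' τy' σy' (P.mkX a) (P.mkX b) (P.mkY c) (P.mkY d) = some u →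
      P.CeilValid a b c d u

/-- **THE PER-LEAF CEILING DEBT IS THE FIVE RULES**:
`SameSideZeroAt P → CeilCrudeSoundAt P → CeilChordSoundAt P → CeilBdrySoundAt P → CeilTipSoundAt P → LeafCeilSoundAt P`. -/
theorem leafCeilSoundAt_of_rules (P : Params) (hSS : SameSideZeroAt P) (hCr : CeilCrudeSoundAt P) (hCh : CeilChordSoundAt P)
    (hB : CeilBdrySoundAt P) (hT : CeilTipSoundAt P) : LeafCeilSoundAt P := by
  intro bd tp a b c d N h
  set x0 := P.mkX a with hx0
  set x1 := P.mkX b with hx1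
  set y0 := P.mkY c with hy0
  set y1 := P.mkY d with hy1
  by_cases hg : (P.cell x0 x1 y0 y1).guards = true
  · rcases hs1 : P.status (P.cell x0 x1 y0 y1).e1Lo (P.cell x0 x1 y0 y1).e1Hi with _ | ⟨_ | _⟩ <;>
      rcases hs2 : P.status (P.cell x0 x1 y0 y1).e2Lo (P.cell x0 x1 y0 y1).e2Hi with _ | ⟨_ | _⟩
    · -- none, none : tip cell
      rcases tp with _ | ⟨τx, σx, τy, σy, τx', σx', τy', σy'⟩
      · simp only [Params.leaf, hg, hs1, hs2, Bool.not_true, Bool.false_eq_true, ↓reduceIte] at h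
        split at h
        · rename_i u v hu hv
          simp only [Option.some.injEq] at h
          have hN : N = min u v := by omega
          subst hN
          exact P.ceilValid_min (hT a b c d _ _ _ _ _ _ _ _ u hg hs1 hs2 hu) (hCr a b c d v hg hv)
        · rename_i u hu hv
          simp only [Option.some.injEq] at h
          have hN : N = u := by omega
          subst hN
          exact hT a b c d _ _ _ _ _ _ _ _ _ hg hs1 hs2 hu
        · rename_i v hu hv
          simp only [Option.some.injEq] at h
          have hN : N = v := by omega
          subst hN
          exact hCr a b c d _ hg hv
        · simp at h
      · simp only [Params.leaf, hg, hs1, hs2, Bool.not_true, Bool.false_eq_true, ↓reduceIte] at h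
        split at h
        · rename_i u v hu hv
          simp only [Option.some.injEq] at h
          have hN : N = min u v := by omega
          subst hN
          exact P.ceilValid_min (hT a b c d _ _ _ _ _ _ _ _ u hg hs1 hs2 hu) (hCr a b c d v hg hv)
        · rename_i u hu hv
          simp only [Option.some.injEq] at h
          have hN : N = u := by omega
          subst hN
          exact hT a b c d _ _ _ _ _ _ _ _ _ hg hs1 hs2 hu
        · rename_i v hu hv
          simp only [Option.some.injEq] at h
          have hN : N = v := by omega
          subst hN
          exact hCr a b c d _ hg hv
        · simp at h
    · -- none, some false : `p` straddles, far point status `false`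
      rcases bd with _ | ⟨σx, σy, τx, τy⟩
      · simp only [Params.leaf, hg, hs1, hs2, Bool.not_true, Bool.not_false, Bool.false_eq_true, ↓reduceIte] at h
        split at h
        · rename_i u v hu hv
          simp only [Option.some.injEq] at h
          have hN : N = min u v := by omega
          subst hN
          exact P.ceilValid_min (hB a b c d false false _ _ u hg (by simpa using hs1) (by simpa using hs2) hu) (hCr a b c d v hg hv)
        · rename_i u hu hv
          simp only [Option.some.injEq] at h
          have hN : N = u := by omega
          subst hN
          exact hB a b c d false false _ _ _ hg (by simpa using hs1) (by simpa using hs2) hu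
        · rename_i v hu hv
          simp only [Option.some.injEq] at h
          have hN : N = v := by omega
          subst hN
          exact hCr a b c d _ hg hv
        · simp at h
      · simp only [Params.leaf, hg, hs1, hs2, Bool.not_true, Bool.not_false, Bool.false_eq_true, ↓reduceIte] at h
        split at h
        · rename_i u v hu hv
          simp only [Option.some.injEq] at h
          have hN : N = min u v := by omega
          subst hN
          exact P.ceilValid_min (hB a b c d false false _ _ u hg (by simpa using hs1) (by simpa using hs2) hu) (hCr a b c d v hg hv)
        · rename_i u hu hv
          simp only [Option.some.injEq] at h
          have hN : N = u := by omega
          subst hN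
          exact hB a b c d false false _ _ _ hg (by simpa using hs1) (by simpa using hs2) hu
        · rename_i v hu hv
          simp only [Option.some.injEq] at h
          have hN : N = v := by omega
          subst hN
          exact hCr a b c d _ hg hv
        · simp at h
    · -- none, some true : `p` straddles, far point status `true`
      rcases bd with _ | ⟨σx, σy, τx, τy⟩
      · simp only [Params.leaf, hg, hs1, hs2, Bool.not_true, Bool.false_eq_true, ↓reduceIte] at h
        split at h
        · rename_i u v hu hv
          simp only [Option.some.injEq] at h
          have hN : N = min u v := by omega
          subst hN
          exact P.ceilValid_min (hB a b c d false true _ _ u hg (by simpa using hs1) (by simpa using hs2) hu) (hCr a b c d v hg hv)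
        · rename_i u hu hv
          simp only [Option.some.injEq] at h
          have hN : N = u := by omega
          subst hN
          exact hB a b c d false true _ _ _ hg (by simpa using hs1) (by simpa using hs2) hu
        · rename_i v hu hv
          simp only [Option.some.injEq] at h
          have hN : N = v := by omega
          subst hN
          exact hCr a b c d _ hg hv
        · simp at h
      · simp only [Params.leaf, hg, hs1, hs2, Bool.not_true, Bool.false_eq_true, ↓reduceIte] at h
        split at h
        · rename_i u v hu hv
          simp only [Option.some.injEq] at h
          have hN : N = min u v := by omega
          subst hN
          exact P.ceilValid_min (hB a b c d false true _ _ u hg (by simpa using hs1) (by simpa using hs2) hu) (hCr a b c d v hg hv)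
        · rename_i u hu hv
          simp only [Option.some.injEq] at h
          have hN : N = u := by omega
          subst hN
          exact hB a b c d false true _ _ _ hg (by simpa using hs1) (by simpa using hs2) hu
        · rename_i v hu hv
          simp only [Option.some.injEq] at h
          have hN : N = v := by omega
          subst hN
          exact hCr a b c d _ hg hv
        · simp at h
    · -- some false, none : `p + q` straddles, `p` status `false`
      rcases bd with _ | ⟨σx, σy, τx, τy⟩
      · simp only [Params.leaf, hg, hs1, hs2, Bool.not_true, Bool.not_false, Bool.false_eq_true, ↓reduceIte] at h
        split at h
        · rename_i u v hu hv
          simp only [Option.some.injEq] at h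
          have hN : N = min u v := by omega
          subst hN
          exact P.ceilValid_min (hB a b c d true false _ _ u hg (by simpa using hs1) (by simpa using hs2) hu) (hCr a b c d v hg hv)
        · rename_i u hu hv
          simp only [Option.some.injEq] at h
          have hN : N = u := by omega
          subst hN
          exact hB a b c d true false _ _ _ hg (by simpa using hs1) (by simpa using hs2) hu
        · rename_i v hu hv
          simp only [Option.some.injEq] at h
          have hN : N = v := by omega
          subst hN
          exact hCr a b c d _ hg hv
        · simp at h
      · simp only [Params.leaf, hg, hs1, hs2, Bool.not_true, Bool.not_false, Bool.false_eq_true, ↓reduceIte] at h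
        split at h
        · rename_i u v hu hv
          simp only [Option.some.injEq] at h
          have hN : N = min u v := by omega
          subst hN
          exact P.ceilValid_min (hB a b c d true false _ _ u hg (by simpa using hs1) (by simpa using hs2) hu) (hCr a b c d v hg hv)
        · rename_i u hu hv
          simp only [Option.some.injEq] at h
          have hN : N = u := by omega
          subst hN
          exact hB a b c d true false _ _ _ hg (by simpa using hs1) (by simpa using hs2) hu
        · rename_i v hu hv
          simp only [Option.some.injEq] at h
          have hN : N = v := by omega
          subst hN
          exact hCr a b c d _ hg hv
        · simp at h
    · -- some false, some false : same side, no mass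
      simp only [Params.leaf, hg, hs1, hs2, Bool.not_true, Bool.false_eq_true, ↓reduceIte] at h
      simp only [Option.some.injEq] at h
      have hN : N = 0 := by omega
      subst hN
      exact hSS a b c d false hg hs1 hs2
    · -- some false, some true : two-shell kind II
      simp only [Params.leaf, hg, hs1, hs2, Bool.not_true, Bool.false_eq_true, ↓reduceIte] at h
      split at h
      · rename_i u v hu hv
        simp only [Option.some.injEq] at h
        have hN : N = min u v := by omega
        subst hN
        exact P.ceilValid_min (hCh a b c d false u hg hs1 hs2 hu) (hCr a b c d v hg hv)
      · rename_i u hu hv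
        simp only [Option.some.injEq] at h
        have hN : N = u := by omega
        subst hN
        exact hCh a b c d false _ hg hs1 hs2 hu
      · rename_i v hu hv
        simp only [Option.some.injEq] at h
        have hN : N = v := by omega
        subst hN
        exact hCr a b c d _ hg hv
      · simp at h
    · -- some true, none : `p + q` straddles, `p` status `true`
      rcases bd with _ | ⟨σx, σy, τx, τy⟩
      · simp only [Params.leaf, hg, hs1, hs2, Bool.not_true, Bool.false_eq_true, ↓reduceIte] at h
        split at h
        · rename_i u v hu hv
          simp only [Option.some.injEq] at h
          have hN : N = min u v := by omega
          subst hN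
          exact P.ceilValid_min (hB a b c d true true _ _ u hg (by simpa using hs1) (by simpa using hs2) hu) (hCr a b c d v hg hv)
        · rename_i u hu hv
          simp only [Option.some.injEq] at h
          have hN : N = u := by omega
          subst hN
          exact hB a b c d true true _ _ _ hg (by simpa using hs1) (by simpa using hs2) hu
        · rename_i v hu hv
          simp only [Option.some.injEq] at h
          have hN : N = v := by omega
          subst hN
          exact hCr a b c d _ hg hv
        · simp at h
      · simp only [Params.leaf, hg, hs1, hs2, Bool.not_true, Bool.false_eq_true, ↓reduceIte] at h
        split at h
        · rename_i u v hu hv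
          simp only [Option.some.injEq] at h
          have hN : N = min u v := by omega
          subst hN
          exact P.ceilValid_min (hB a b c d true true _ _ u hg (by simpa using hs1) (by simpa using hs2) hu) (hCr a b c d v hg hv)
        · rename_i u hu hv
          simp only [Option.some.injEq] at h
          have hN : N = u := by omega
          subst hN
          exact hB a b c d true true _ _ _ hg (by simpa using hs1) (by simpa using hs2) hu
        · rename_i v hu hv
          simp only [Option.some.injEq] at h
          have hN : N = v := by omega
          subst hN
          exact hCr a b c d _ hg hv
        · simp at h
    · -- some true, some false : two-shell kind I
      simp only [Params.leaf, hg, hs1, hs2, Bool.not_true, Bool.false_eq_true, ↓reduceIte] at h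
      split at h
      · rename_i u v hu hv
        simp only [Option.some.injEq] at h
        have hN : N = min u v := by omega
        subst hN
        exact P.ceilValid_min (hCh a b c d true u hg hs1 hs2 hu) (hCr a b c d v hg hv)
      · rename_i u hu hv
        simp only [Option.some.injEq] at h
        have hN : N = u := by omega
        subst hN
        exact hCh a b c d true _ hg hs1 hs2 hu
      · rename_i v hu hv
        simp only [Option.some.injEq] at h
        have hN : N = v := by omega
        subst hN
        exact hCr a b c d _ hg hv
      · simp at h
    · -- some true, some true : same side, no mass
      simp only [Params.leaf, hg, hs1, hs2, Bool.not_true, Bool.false_eq_true, ↓reduceIte] at h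
      simp only [Option.some.injEq] at h
      have hN : N = 0 := by omega
      subst hN
      exact hSS a b c d true hg hs1 hs2
  · -- failed guards: `(0, none)` certifies nothing
    have hg' : (P.cell x0 x1 y0 y1).guards = false := by simpa using hg
    simp [Params.leaf, hg'] at h

/-- **CEILING SOUNDNESS FROM THE FIVE RULES, for every certificate tree.** -/
theorem ceilSoundAt_of_rules (P : Params) (hSS : SameSideZeroAt P) (hCr : CeilCrudeSoundAt P) (hCh : CeilChordSoundAt P)
    (hB : CeilBdrySoundAt P) (hT : CeilTipSoundAt P) (t : QB) : CeilSoundAt P t :=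
  ceilSoundAt_of_leafCeilSound P (leafCeilSoundAt_of_rules P hSS hCr hCh hB hT) t

end Summit.HubbardSuperconductivity.HubbardSuperconductivity.Theorems.KlLindhardEnclosure

end
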